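import Summits.KontsevichZagierPeriods.KontsevichZagierPeriods.Theorems.DilationMove.Negative.LoadBearing
import Summits.KontsevichZagierPeriods.KontsevichZagierPeriods.Theorems.HurwitzMicroSectorsDilationMoveStubIsSemialgebraicMapOnCoordPow
import Literature.NumberTheory.Transcendental.BoxCoordinatePowerMap
import Literature.NumberTheory.Transcendental.KZFibredRelations

/-!
# `DilationMove` (stmt-KontsevichZagierPeriods-3872) — negative side, line `coordpow-api-assembly`:
the structural refutation channel for rule (2) and the load-bearing hypotheses of `stub_orthantCoordPowMove`

Refuter (`drefute`) by-products for the picked line of the crux `DilationMove` (route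
`HurwitzMicroSectors`). The line's two registered stubs (`stub_isSemialgebraicMapOn_coordPow`,
`stub_orthantCoordPowMove` — the dilation `x ↦ (xᵢ^m)ᵢ` is ONE change-of-variables move on any
`ℚ`-semialgebraic domain inside the open orthant, target = the symbolic image) SURVIVE and are landed
(`Theorems/HurwitzMicroSectorsDilationMoveStub*.lean`); this file records what any proof of the second
stub must use, and packages a second refutation channel. Theorems only (no named statements).

* §S STRUCTURAL CHANNEL for rule (2) (complements the soundness channel `value_eq_of_mem` of
  `LoadBearing.lean`, which is blind whenever the two values agree): the free-group pinning
  `KZ.sigma_eq_of_of_sub_of_eq` (Literature `KZFibredRelations`; done inline before in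
  `PlanarK0Injective/Negative/OneMove.lean`) gives, for `r ≠ r'`, that membership
  `[r] − [r'] ∈ changeOfVariablesRel` hands back the change-of-variables DATA FOR `(r, r')` ITSELF —
  a `ℚ`-semialgebraic `Φ`, injective on `r.domain`, with `r'.domain = Φ '' r.domain` and the Jacobian
  identity (`covData_of_mem`, `mem_changeOfVariablesRel_iff_of_ne`, every dimension). One-move
  statements can then be refuted by cardinality / injectivity / topology of the two domains.
* §M LOAD-BEARING HYPOTHESES of `stub_orthantCoordPowMove` (registered signature, skeleton sha
  7500539be930; each theorem negates that signature verbatim with ONE hypothesis deleted):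
  `orthantCoordPowMove_false_without_oneLe` — `1 ≤ m` (m = 0, n = 1: source `[(0,1), 0]`, target
  `[{1}, 0]` = the image of the box under the constant map `coordPow 0`; both VALUES are `0`, so only
  the structural channel sees it: no injection of `(0,1)` onto a point);
  `orthantCoordPowMove_false_without_image` — the image clause (⟸ `not_dilationMoveBoxes_target`);
  `orthantCoordPowMove_false_without_jacobian` — the Jacobian factor (⟸ `not_dilationMoveJac_noJacobian`).
  The orthant hypothesis itself is load-bearing exactly for EVEN `m` (m = 2, n = 1: `[(-1,1), 2t]` vs
  `[[0,1), 1]`, values `0 ≠ 1`; removable for odd `m`) — that analysis is the standing disprover's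
  (`Cruxes/DilationMove/Disproof.lean` §E.2) and is not repeated here. The remaining hypothesis
  `IsSemialgebraicMapOn ℚ r.domain (coordPow m)` is not load-bearing: it is the landed first stub.
[Kontsevich–Zagier 2001, §1.2, rule (2)]
-/

noncomputable section

open Set MvPolynomial MeasureTheory intervalIntegral
open Literature.NumberTheory.Transcendental Literature.ModelTheory.ExponentialFields
open Summit.KontsevichZagierPeriods.HurwitzMicroSectors.DilationMove (stub_isSemialgebraicMapOn_coordPow)

namespace Summit.KontsevichZagierPeriods.HurwitzMicroSectors.DilationMoveNegative

/-! ## §S The structural channel for rule (2) -/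

/-- **Structural channel.** If `r ≠ r'` and `[r] − [r'] ∈ changeOfVariablesRel`, then the
change-of-variables data exist FOR THE PAIR `(r, r')` itself: a `ℚ`-semialgebraic `Φ`, differentiable
within and injective on `r.domain`, with `r'.domain = Φ '' r.domain` and
`r.integrand x = r'.integrand (Φ x)·|det Φ' x|` on `r.domain` (free-group pinning
`KZ.sigma_eq_of_of_sub_of_eq`). [Kontsevich–Zagier 2001, §1.2, rule (2)] -/
theorem covData_of_mem {n : ℕ} {r r' : KZ.IntegralRep n} (hne : r ≠ r')
    (h : KZ.of r - KZ.of r' ∈ KZ.changeOfVariablesRel) :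
    ∃ (Φ : (Fin n → ℝ) → (Fin n → ℝ)) (Φ' : (Fin n → ℝ) → (Fin n → ℝ) →L[ℝ] (Fin n → ℝ)),
      IsSemialgebraicMapOn ℚ r.domain Φ ∧ (∀ x ∈ r.domain, HasFDerivWithinAt Φ (Φ' x) r.domain x) ∧
      InjOn Φ r.domain ∧ r'.domain = Φ '' r.domain ∧
      (∀ x ∈ r.domain, r.integrand x = r'.integrand (Φ x) * |(Φ' x).det|) := by
  obtain ⟨n', a, b, Φ, Φ', h1, h2, h3, h4, h5, hc⟩ := h
  have hne' : (⟨n, r⟩ : Σ k, KZ.IntegralRep k) ≠ ⟨n, r'⟩ := fun e => hne (by cases e; rfl)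
  obtain ⟨e1, e2⟩ := KZ.sigma_eq_of_of_sub_of_eq hne' hc
  cases e1
  cases e2
  exact ⟨Φ, Φ', h1, h2, h3, h4, h5⟩

/-- For `r ≠ r'`, `[r] − [r'] ∈ changeOfVariablesRel` IFF the change-of-variables data exist for
`(r, r')`. [Kontsevich–Zagier 2001, §1.2, rule (2)] -/
theorem mem_changeOfVariablesRel_iff_of_ne {n : ℕ} {r r' : KZ.IntegralRep n} (hne : r ≠ r') :
    KZ.of r - KZ.of r' ∈ KZ.changeOfVariablesRel ↔
    ∃ (Φ : (Fin n → ℝ) → (Fin n → ℝ)) (Φ' : (Fin n → ℝ) → (Fin n → ℝ) →L[ℝ] (Fin n → ℝ)),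
      IsSemialgebraicMapOn ℚ r.domain Φ ∧ (∀ x ∈ r.domain, HasFDerivWithinAt Φ (Φ' x) r.domain x) ∧
      InjOn Φ r.domain ∧ r'.domain = Φ '' r.domain ∧
      (∀ x ∈ r.domain, r.integrand x = r'.integrand (Φ x) * |(Φ' x).det|) :=
  ⟨covData_of_mem hne, fun ⟨Φ, Φ', h1, h2, h3, h4, h5⟩ => ⟨n, r, r', Φ, Φ', h1, h2, h3, h4, h5, rfl⟩⟩

/-! ## §M Load-bearing hypotheses of `stub_orthantCoordPowMove` -/

/-- The point `{1} ⊆ ℝ¹` is `ℚ`-semialgebraic. [folklore] -/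
theorem isSemialgebraic_pointOne : IsSemialgebraic ℚ {y : Fin 1 → ℝ | y 0 = 1} := by
  convert isSemialgebraic_setOf_eval_eq_zero (k := ℚ) (R := ℝ) (ι := Fin 1) (X 0 - C 1) using 2 with y
  simp [sub_eq_zero]

/-- `coordPow 0` is the constant map `1`: its image of the unit interval box is the point `{1}`.
[folklore] -/
theorem image_coordPow_zero_ibox :
    (fun x : Fin 1 → ℝ => BoxIntegral.coordPow 0 x) '' ibox 1 0 1 = {y : Fin 1 → ℝ | y 0 = 1} := by
  ext y
  simp only [mem_image, mem_setOf_eq]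
  constructor
  · rintro ⟨x, -, rfl⟩
    simp [BoxIntegral.coordPow]
  · intro hy
    refine ⟨fun _ => 1 / 2, fun i => ⟨by norm_num, by norm_num⟩, ?_⟩
    funext i
    fin_cases i
    simpa [BoxIntegral.coordPow] using hy.symm

/-- **`1 ≤ m` is load-bearing in `stub_orthantCoordPowMove`** (the registered signature with
`1 ≤ m` deleted is false). At `m = 0`, `n = 1` the source `[(0,1), 0]` (`monoRep 0 1 0 0`) and the
one-point target `[{1}, 0]` satisfy every remaining hypothesis (the typed factor `0¹·t^(0-1)` is `0`;
the image of the box under the constant map `coordPow 0 = 1` is the point). Both VALUES are `0`, so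
the soundness channel is blind; the structural channel `covData_of_mem` demands an injection of
`(0,1)` onto a point — impossible (`1/4 ≠ 1/2`). [folklore] -/
theorem orthantCoordPowMove_false_without_oneLe :
    ¬ (∀ (n m : ℕ) (r r' : KZ.IntegralRep n), r.domain ⊆ {x | ∀ i, 0 < x i} →
        IsSemialgebraicMapOn ℚ r.domain (fun x : Fin n → ℝ => BoxIntegral.coordPow m x) →
        r'.domain = (fun x : Fin n → ℝ => BoxIntegral.coordPow m x) '' r.domain →
        (∀ x ∈ r.domain, r.integrand x =
          r'.integrand (BoxIntegral.coordPow m x) * ((m : ℝ) ^ n * ∏ i, x i ^ (m - 1))) →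
        KZ.of r - KZ.of r' ∈ KZ.changeOfVariablesRel) := by
  intro h
  -- the one-point target representation `[{1}, 0]`
  let p : KZ.IntegralRep 1 :=
    { domain := {y | y 0 = 1}
      integrand := fun _ => 0
      isSemialgebraic_domain := isSemialgebraic_pointOne
      isSemialgebraicFunOn_integrand :=
        (isSemialgebraicFunOn_aeval isSemialgebraic_pointOne (0 : MvPolynomial (Fin 1) ℚ)).congr
          (fun x _ => by simp)
      integrableOn := integrableOn_zero }
  have hpdom : p.domain = {y | y 0 = 1} := rfl
  have hpint : ∀ y, p.integrand y = 0 := fun _ => rfl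
  have hmem := h 1 0 (monoRep 0 1 0 0) p
    (fun x hx i => by simpa using (hx i).1)
    (stub_isSemialgebraicMapOn_coordPow 1 0 _ (monoRep 0 1 0 0).isSemialgebraic_domain)
    (by rw [monoRep_domain, image_coordPow_zero_ibox, hpdom])
    (fun x _ => by simp [hpint])
  have hne : monoRep 0 1 0 0 ≠ p := by
    intro e
    have hd := congrArg KZ.IntegralRep.domain e
    have hx : (fun _ : Fin 1 => (1 / 2 : ℝ)) ∈ (monoRep 0 1 0 0).domain :=
      fun i => ⟨by norm_num, by norm_num⟩
    rw [hd, hpdom] at hx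
    norm_num [Set.mem_setOf_eq] at hx
  obtain ⟨Φ, Φ', -, -, hinj, himg, -⟩ := covData_of_mem hne hmem
  rw [hpdom] at himg
  have ha : (fun _ : Fin 1 => (1 / 4 : ℝ)) ∈ (monoRep 0 1 0 0).domain :=
    fun i => ⟨by norm_num, by norm_num⟩
  have hb : (fun _ : Fin 1 => (1 / 2 : ℝ)) ∈ (monoRep 0 1 0 0).domain :=
    fun i => ⟨by norm_num, by norm_num⟩
  have hΦa : Φ (fun _ => 1 / 4) ∈ {y : Fin 1 → ℝ | y 0 = 1} := by rw [himg]; exact mem_image_of_mem Φ ha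
  have hΦb : Φ (fun _ => 1 / 2) ∈ {y : Fin 1 → ℝ | y 0 = 1} := by rw [himg]; exact mem_image_of_mem Φ hb
  have hab : Φ (fun _ => 1 / 4) = Φ (fun _ => 1 / 2) := by
    funext i
    fin_cases i
    exact hΦa.trans hΦb.symm
  have := congr_fun (hinj ha hb hab) 0
  norm_num at this

/-- **The image clause is load-bearing in `stub_orthantCoordPowMove`** (the registered signature
with `r'.domain = Φ '' r.domain` deleted is false): its `m = 1` instance contains the landed false
box variant `DilationMoveBoxes 1 1 0 1 0 2` (source `(0,1)`, target `(0,2)`, integrands `1`; values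
`1 ≠ 2`, `not_dilationMoveBoxes_target`). [folklore] -/
theorem orthantCoordPowMove_false_without_image :
    ¬ (∀ (n m : ℕ), 1 ≤ m → ∀ (r r' : KZ.IntegralRep n), r.domain ⊆ {x | ∀ i, 0 < x i} →
        IsSemialgebraicMapOn ℚ r.domain (fun x : Fin n → ℝ => BoxIntegral.coordPow m x) →
        (∀ x ∈ r.domain, r.integrand x =
          r'.integrand (BoxIntegral.coordPow m x) * ((m : ℝ) ^ n * ∏ i, x i ^ (m - 1))) →
        KZ.of r - KZ.of r' ∈ KZ.changeOfVariablesRel) := fun h =>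
  not_dilationMoveBoxes_target fun r r' hr _ hint =>
    h 1 1 le_rfl r r' (by rw [hr]; exact fun x hx i => by simpa using (hx i).1)
      (stub_isSemialgebraicMapOn_coordPow 1 1 _ r.isSemialgebraic_domain)
      (fun x hx => hint x hx)

/-- **The Jacobian factor is load-bearing in `stub_orthantCoordPowMove`** (the registered signature
with the factor `mⁿ ∏ xᵢ^(m-1)` deleted is false): its `m = 2` instance on the unit box (image = the
box, `BoxIntegral.image_coordPow_box`) contains the landed false variant `DilationMoveJac 1 2 1 0`
(`r = [(0,1), t²]`, `r' = [(0,1), t]`; values `1/3 ≠ 1/2`, `not_dilationMoveJac_noJacobian`).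
[folklore] -/
theorem orthantCoordPowMove_false_without_jacobian :
    ¬ (∀ (n m : ℕ), 1 ≤ m → ∀ (r r' : KZ.IntegralRep n), r.domain ⊆ {x | ∀ i, 0 < x i} →
        IsSemialgebraicMapOn ℚ r.domain (fun x : Fin n → ℝ => BoxIntegral.coordPow m x) →
        r'.domain = (fun x : Fin n → ℝ => BoxIntegral.coordPow m x) '' r.domain →
        (∀ x ∈ r.domain, r.integrand x = r'.integrand (BoxIntegral.coordPow m x)) →
        KZ.of r - KZ.of r' ∈ KZ.changeOfVariablesRel) := fun h =>
  not_dilationMoveJac_noJacobian fun r r' hr hr' hint =>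
    h 1 2 (by norm_num) r r' (by rw [hr]; exact fun x hx i => (hx i).1)
      (stub_isSemialgebraicMapOn_coordPow 1 2 _ r.isSemialgebraic_domain)
      (by rw [hr', hr]; exact (BoxIntegral.image_coordPow_box two_ne_zero).symm)
      (fun x hx => by rw [hint x hx]; show _ = r'.integrand (fun i => x i ^ 2); simp)

end Summit.KontsevichZagierPeriods.HurwitzMicroSectors.DilationMoveNegative
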